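import Mathlib.Data.Nat.Basic
import HarnessLib

/-!
# Kottwitz (1986) §10: elliptic and fundamental tori (review) — Lemmas 10.1, 10.2, 10.4 and the construction 10.3,
# as a LETTER: one posited datum, the printed statements as relations over it, nothing asserted
(R. E. Kottwitz, *Stable trace formula: elliptic singular terms*, Math. Ann. 275 (1986) 365–399, §10 pp. 397–398)

Topic `NumberTheory/Kottwitz1986`; namespace `Literature.NumberTheory.Kottwitz1986.EllipticTori`.  STATEMENTS ONLY: one
`structure EllipticToriData` (the maximal `F`-tori of a connected reductive group `G` over a `p`-adic or real field `F`, the pointed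
sets `H¹(F, T)`, `H¹(F, G)` with the natural map, `H²(F, T)`, and the printed predicates — every field a bare carrier, map or predicate
with its page pin) and `Prop`-valued relations (one `def` per printed statement, verbatim numbering).  No theorem, no proof, no `sorry`,
no `axiom`, no instance, no notation.  Cell hodgecm-mathlib, carpet squad TK (seat TK-t06).  The tree's ★
`Literature.NumberTheory.GaloisCohomology.NonAbelianH1` (`NonAbelianH1 Γ A`, `H1toNonAbelian`, `kerH1`) is the pointed-set `H¹` of an
ABSTRACT group `Γ` acting on `A` (no continuity: «take `Γ` finite∕discrete»), hence is not instantiated on `Gal(F̄/F)` here; the Galois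
cohomology of the print is POSITED (a later edition may pin `H1T`, `H1G`, `h1Map` to that file over a finite splitting extension).
HC_CM is proved only modulo the printed citations until rung 0 closes; nothing here is about HC.

## Source (open-access digitisation GDZ PPN235181684_0275 LOG_0056, store key `paper:url-ecbc59a1db27`; read from the page images of
## pp. 397–398, canvas = printed page + 6)

[p. 397] «10. Elliptic and Fundamental Tori (Review).  In this section `F` is either `p`-adic or real, and `G` is a connected reductive
group over `F`. In the real case a maximal `ℝ`-torus `T` of `G` is said to be *fundamental* if the dimension of its split component is as
small as possible. In order to have uniform statements we adopt the same terminology in the `p`-adic case; in this case fundamental tori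
are elliptic [Kn; II, p. 271].»  **10.1. LEMMA**: «Let `T` be a maximal `F`-torus of `G`. If `T` transfers to every inner form of `G`, then
`H¹(F, T) → H¹(F, G)` is surjective. If `G` is an adjoint group, then the converse is true.» «This lemma is true for any field `F`.»
**10.2. LEMMA**: «Let `T` be a fundamental torus of `G`. Then `H¹(F, T) → H¹(F, G)` is surjective.»  [p. 398] «It follows from Lemma 2.8
of [S1] that in the real case `T` transfers to the fundamental torus of any inner form `G`»; **10.3**: «The following description of the
fundamental torus in a quasi-split real group `G` will be used in 10.4. Let `B₀` be a Borel subgroup of `G` defined over `ℝ` and let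
`T₀` be a maximal `ℝ`-torus of `B₀`. Let `ω₀` be the longest element of the Weyl group `Ω` of `T₀`. We have `ω₀ ∈ Ω(ℝ)`, since `B₀` is
defined over `ℝ`, and we also have `ω₀² = 1`. Therefore `ω₀` can be used to twist `T₀`. The twisted torus `T` appears in `G` since `G` is
quasi-split. It is clear that `T` has no real roots; therefore `T` is fundamental.»  **10.4. LEMMA**: «Assume that `G` is a simply
connected semi-simple group. Let `T` be a fundamental torus of `G`. Then `H²(F, T)` is trivial.» (proof: `p`-adic — `T` anisotropic,
Tate–Nakayama; real — `T = T_a × T_i`, `T_a` anisotropic, `T_i = R_{ℂ/ℝ}(S)`.)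

## What is typed

`EllipticToriData` (posited datum); relations `PadicFundamentalIsElliptic` (the terminological sentence of p. 397), **`Kottwitz1986_10_1`**,
`Kottwitz1986_10_1_converse`, **`Kottwitz1986_10_2`**, `RealTransfersToFundamental` (the [S1] sentence of p. 398), `Sec103` (the twisted torus
of 10.3 lies in `G`, has no real roots and is fundamental), **`Kottwitz1986_10_4`**, and the conjunction `PrintedLaws10`.  NOT typed: the
cohomology itself, Kneser's `H¹(F, G) ≅ H²(F, C)` and the diagram of p. 397 (proof steps).
-/

namespace Literature.NumberTheory.Kottwitz1986.EllipticTori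

universe u

/-! ## §1 The posited datum of §10 -/

/-- **The data of Kottwitz's §10 AS A DATUM.**  Behind it: a field `F` that is either `p`-adic or real (`IsPadic`, `IsReal`) and a connected
reductive `F`-group `G`.  Fields: the maximal `F`-tori of `G` (`Torus`), its inner forms (`InnerForm`), «`T` transfers to
the inner form `G′`» (`TransfersTo`), the split rank of a torus (`splitRank`), elliptic (`IsElliptic`), «has no real roots» (`NoRealRoots`),
the pointed sets `H¹(F, T)`, `H¹(F, G)` with the natural map (`H1T`, `H1G`, `h1Map`), «`H²(F, T)` is trivial» (`H2Trivial`), `G` adjoint ∕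
simply connected semisimple ∕ quasi-split (`IsAdjoint`, `IsSimplyConnectedSemisimple`, `IsQuasiSplit`), and for 10.3 the tori obtained by
twisting the maximal torus `T₀` of a real Borel subgroup `B₀` by the longest Weyl element `ω₀` (`TwistedByLongest`).  No field asserts a
printed statement. [cite: Kottwitz1986, §10 (pp. 397–398)] -/
structure EllipticToriData : Type (u + 1) where
  /-- `F` is `p`-adic [§10 p. 397] -/
  IsPadic : Prop
  /-- `F` is real [§10 p. 397] -/
  IsReal : Prop
  /-- the maximal `F`-tori `T` of `G` [§10 p. 397] -/
  Torus : Type u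
  /-- the inner forms `G′` of `G` [Lemma 10.1 p. 397] -/
  InnerForm : Type u
  /-- «`T` transfers to the inner form `G′`» [Lemma 10.1 p. 397] -/
  TransfersTo : Torus → InnerForm → Prop
  /-- the dimension of the split component of `T` [§10 p. 397] -/
  splitRank : Torus → ℕ
  /-- `T` is elliptic [§10 p. 397] -/
  IsElliptic : Torus → Prop
  /-- «`T` has no real roots» [10.3 p. 398] -/
  NoRealRoots : Torus → Prop
  /-- the pointed set `H¹(F, T)` [Lemma 10.1 p. 397] -/
  H1T : Torus → Type u
  /-- the pointed set `H¹(F, G)` [Lemma 10.1 p. 397] -/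
  H1G : Type u
  /-- the natural map `H¹(F, T) → H¹(F, G)` [Lemma 10.1 p. 397] -/
  h1Map : (T : Torus) → H1T T → H1G
  /-- «`H²(F, T)` is trivial» [Lemma 10.4 p. 398] -/
  H2Trivial : Torus → Prop
  /-- «`G` is an adjoint group» [Lemma 10.1 p. 397] -/
  IsAdjoint : Prop
  /-- «`G` is a simply connected semi-simple group» [Lemma 10.4 p. 398] -/
  IsSimplyConnectedSemisimple : Prop
  /-- `G` is quasi-split [10.3 p. 398] -/
  IsQuasiSplit : Prop
  /-- (real quasi-split case) the tori obtained by twisting the maximal `ℝ`-torus `T₀` of a Borel subgroup `B₀` defined over `ℝ` by the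
  longest element `ω₀ ∈ Ω(ℝ)`, `ω₀² = 1`, realised as maximal tori of `G` («The twisted torus `T` appears in `G` since `G` is
  quasi-split») [10.3 p. 398] -/
  TwistedByLongest : Torus → Prop

namespace EllipticToriData

variable (D : EllipticToriData.{u})

/-! ## §2 Defined objects -/

/-- **«a maximal `ℝ`-torus `T` of `G` is said to be fundamental if the dimension of its split component is as small as possible»** (same
terminology adopted in the `p`-adic case). [cite: Kottwitz1986, §10 (p. 397)] -/
def IsFundamental (T : D.Torus) : Prop :=
  ∀ T' : D.Torus, D.splitRank T ≤ D.splitRank T'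

/-- «`T` transfers to every inner form of `G`». [cite: Kottwitz1986, Lemma 10.1 (p. 397)] -/
def TransfersToEveryInnerForm (T : D.Torus) : Prop :=
  ∀ G' : D.InnerForm, D.TransfersTo T G'

/-! ## §3 The printed statements of §10 as relations -/

/-- **«in this case [the `p`-adic case] fundamental tori are elliptic [Kn; II, p. 271]»**, AS A RELATION. [cite: Kottwitz1986, §10 (p. 397)] -/
def PadicFundamentalIsElliptic : Prop :=
  D.IsPadic → ∀ T : D.Torus, D.IsFundamental T → D.IsElliptic T

/-- **10.1. LEMMA (first statement)**: «Let `T` be a maximal `F`-torus of `G`. If `T` transfers to every inner form of `G`, then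
`H¹(F, T) → H¹(F, G)` is surjective.» («This lemma is true for any field `F`.»), AS A RELATION. [cite: Kottwitz1986, Lemma 10.1 (p. 397)] -/
def Kottwitz1986_10_1 : Prop :=
  ∀ T : D.Torus, D.TransfersToEveryInnerForm T → Function.Surjective (D.h1Map T)

/-- **10.1. LEMMA (converse)**: «If `G` is an adjoint group, then the converse is true.», AS A RELATION. [cite: Kottwitz1986, Lemma 10.1 (p. 397)] -/
def Kottwitz1986_10_1_converse : Prop :=
  D.IsAdjoint → ∀ T : D.Torus, Function.Surjective (D.h1Map T) → D.TransfersToEveryInnerForm T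

/-- **10.2. LEMMA**: «Let `T` be a fundamental torus of `G`. Then `H¹(F, T) → H¹(F, G)` is surjective.», AS A RELATION.
[cite: Kottwitz1986, Lemma 10.2 (p. 397)] -/
def Kottwitz1986_10_2 : Prop :=
  ∀ T : D.Torus, D.IsFundamental T → Function.Surjective (D.h1Map T)

/-- **«It follows from Lemma 2.8 of [S1] that in the real case `T` transfers to the fundamental torus of any inner form `G`»** (`T`
fundamental): in the real case a fundamental torus transfers to every inner form, AS A RELATION. [cite: Kottwitz1986, §10 (p. 398)] -/
def RealTransfersToFundamental : Prop :=
  D.IsReal → ∀ T : D.Torus, D.IsFundamental T → D.TransfersToEveryInnerForm T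

/-- **10.3**: in a quasi-split real group the torus obtained by twisting `T₀ ⊂ B₀` by the longest Weyl element `ω₀` exists in `G`, «has
no real roots; therefore `T` is fundamental», AS A RELATION. [cite: Kottwitz1986, §10.3 (p. 398)] -/
def Sec103 : Prop :=
  D.IsReal → D.IsQuasiSplit →
    (∃ T : D.Torus, D.TwistedByLongest T) ∧ ∀ T : D.Torus, D.TwistedByLongest T → D.NoRealRoots T ∧ D.IsFundamental T

/-- **10.4. LEMMA**: «Assume that `G` is a simply connected semi-simple group. Let `T` be a fundamental torus of `G`. Then `H²(F, T)` is
trivial.», AS A RELATION. [cite: Kottwitz1986, Lemma 10.4 (p. 398)] -/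
def Kottwitz1986_10_4 : Prop :=
  D.IsSimplyConnectedSemisimple → ∀ T : D.Torus, D.IsFundamental T → D.H2Trivial T

/-- The conjunction of the §10 relations. [cite: Kottwitz1986, §10 (pp. 397–398)] -/
def PrintedLaws10 : Prop :=
  D.PadicFundamentalIsElliptic ∧ D.Kottwitz1986_10_1 ∧ D.Kottwitz1986_10_1_converse ∧ D.Kottwitz1986_10_2 ∧
    D.RealTransfersToFundamental ∧ D.Sec103 ∧ D.Kottwitz1986_10_4

end EllipticToriData

end Literature.NumberTheory.Kottwitz1986.EllipticTori
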